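import Mathlib
import Literature.Analysis.ODE.RegularSingularLogBranchScalar
import HarnessLib

/-!
# The analytic and logarithmic Frobenius branches on the SHARP disc: coefficient bounds with any rate
# `μ > a` from a finite jet, and the equations wherever such a bound converges

Topic `Literature/Analysis/ODE` (namespace `Literature.Analysis.ODE`). The built-in majorant of
`RegularSingularAnalyticBranch.lean` (`‖vₙ‖ ≤ B λⁿ`, `λ = a(1 + 2cK)`) is uniform and cheap but PESSIMISTIC: the true
radius of convergence is `1/a`, while `1/λ` can be smaller by orders of magnitude (for the marginal tearing-mode
equation of a standard peaked current profile the generic scalar radius `min ρ₀ 1/(λ'+1)` of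
`RegularSingularLogBranchScalar.lean` is `≈ 6·10⁻⁶` although every coefficient function converges on the unit disc).
Certificates that must MATCH a validated outer solution to the local Frobenius pair need the patch on a disc of
practical size. The classical remedy [cite: CoddingtonLevinson1955, Ch. 4 §3]: the resolvent factor `‖Rₙ‖ ≤ c/n`
makes the recursion contractive for large `n` at ANY rate `μ > a`, so a bound `‖vₙ‖ ≤ B μⁿ` verified on a finite jet
`n < N` (exact arithmetic) propagates to all `n` as soon as `N` passes the explicit threshold
`c (K B a/(μ − a) + G) ≤ N B`.

* `norm_frobeniusCoeff_le_of_jet` — THE SHARP MAJORANT from a finite jet (any `μ > a`);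
* `IsFrobeniusData.frobeniusSol_ode_of_bound` — convergence, term-wise derivative and the equation
  `x • v′ = (Σ xᵏ • Mₖ) v + Σ xᵏ • gₖ` on the disc `μ‖x‖ < 1` of ANY proven coefficient bound (`μ ≥ a`);
* `IsFrobeniusData.frobeniusLogSol_ode_of_bound` — the same for the logarithmic branch `κ ℓ • Y_s + W` of
  `RegularSingularLogBranch.lean`, given bounds on both coefficient sequences;
* `IsScalarLogData.smallSol_of_bound`, `IsScalarLogData.logSol_of_bound` — the scalar conclusions of
  `RegularSingularLogBranchScalar.lean` (`x y″ + p y′ + q y = 0`, `p₀ = 0`) at every `x` with `‖x‖ < ρ₀`, `μ‖x‖ < 1`.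

## References
* E. A. Coddington, N. Levinson, *Theory of Ordinary Differential Equations*, McGraw–Hill 1955, Ch. 4 §§3, 8 (the
  majorant method at a singularity of the first kind; the logarithmic case). Key `CoddingtonLevinson1955`.
-/

noncomputable section

open Finset Filter Metric
open scoped Topology NNReal ENNReal

namespace Literature.Analysis.ODE

variable {𝕜 : Type*} [RCLike 𝕜] {E : Type*} [NormedAddCommGroup E] [NormedSpace 𝕜 E]

/-! ### A finite jet upgrades the majorant to any rate `μ > a` -/

/-- The geometric identity `(μ − a) Σ_{k<n} a^{n−k} μᵏ = a (μⁿ − aⁿ)`. [cite: CoddingtonLevinson1955, Ch. 4 §3] -/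
theorem jet_majorant_telescope (a μ : ℝ) (n : ℕ) :
    (μ - a) * ∑ k ∈ range n, a ^ (n - k) * μ ^ k = a * (μ ^ n - a ^ n) := by
  have hS : ∑ k ∈ range n, a ^ (n - k) * μ ^ k = a * ∑ k ∈ range n, μ ^ k * a ^ (n - 1 - k) := by
    rw [Finset.mul_sum]
    refine Finset.sum_congr rfl fun k hk => ?_
    have hk' : n - k = (n - 1 - k) + 1 := by have := mem_range.1 hk; omega
    rw [hk', pow_succ]
    ring
  rw [hS, mul_left_comm, ← geom_sum₂_mul]
  ring

/-- **SHARP MAJORANT FROM A JET.** In the setting of `norm_frobeniusCoeff_le` (`‖Mₖ‖ ≤ K aᵏ`, `‖gₖ‖ ≤ G aᵏ` for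
`k ≥ 1`, `‖Rₙ‖ ≤ c/n` for `n ≥ 1`), fix ANY rate `μ > a` and `B ≥ ‖v₀‖`. If the first `N` coefficients satisfy
`‖vₙ‖ ≤ B μⁿ` (`n < N`; a finite computation) and `N` is past the contraction threshold
`c (K B a/(μ − a) + G) ≤ N B`, then `‖vₙ‖ ≤ B μⁿ` for ALL `n`: the analytic branch converges on `‖x‖ < 1/μ`, i.e.
up to the true radius as `μ ↓ a`. (Induction: for `n ≥ N`,
`‖vₙ‖ ≤ (c/n)(K B Σ_{k<n} a^{n−k} μᵏ + G aⁿ) ≤ (c/n) μⁿ (K B a/(μ−a) + G) ≤ B μⁿ`.)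
[cite: CoddingtonLevinson1955, Ch. 4 §3] -/
theorem norm_frobeniusCoeff_le_of_jet {M : ℕ → E →L[𝕜] E} {g : ℕ → E} {R : ℕ → E →L[𝕜] E} {v₀ : E}
    {a K G c μ B : ℝ} {N : ℕ} (ha : 0 ≤ a) (hK : 0 ≤ K) (hG : 0 ≤ G) (hc : 0 ≤ c)
    (hM : ∀ k : ℕ, 1 ≤ k → ‖M k‖ ≤ K * a ^ k) (hg : ∀ k : ℕ, 1 ≤ k → ‖g k‖ ≤ G * a ^ k)
    (hRn : ∀ n : ℕ, 1 ≤ n → ‖R n‖ ≤ c / n) (hμ : a < μ) (hB₀ : ‖v₀‖ ≤ B)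
    (hjet : ∀ n : ℕ, n < N → ‖frobeniusCoeff M g R v₀ n‖ ≤ B * μ ^ n)
    (hN : c * (K * B * a / (μ - a) + G) ≤ N * B) (n : ℕ) :
    ‖frobeniusCoeff M g R v₀ n‖ ≤ B * μ ^ n := by
  have hB : 0 ≤ B := (norm_nonneg _).trans hB₀
  have hμ0 : 0 ≤ μ := ha.trans hμ.le
  have hμa : 0 < μ - a := sub_pos.2 hμ
  induction n using Nat.strong_induction_on with | _ n ih => ?_
  rcases lt_or_ge n N with hn | hn
  · exact hjet n hn
  rcases Nat.eq_zero_or_pos n with rfl | hn1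
  · simpa using hB₀
  have hn0 : (0 : ℝ) < n := by exact_mod_cast hn1
  set S := ∑ k ∈ range n, a ^ (n - k) * μ ^ k with hS
  have hS0 : 0 ≤ S := Finset.sum_nonneg fun k _ => by positivity
  have hSle : S ≤ a * μ ^ n / (μ - a) := by
    rw [le_div_iff₀ hμa, mul_comm]
    have key := jet_majorant_telescope a μ n
    rw [key]
    nlinarith [pow_nonneg ha n]
  have hsum : ‖∑ k ∈ range n, M (n - k) (frobeniusCoeff M g R v₀ k)‖ ≤ K * B * S := by
    calc ‖∑ k ∈ range n, M (n - k) (frobeniusCoeff M g R v₀ k)‖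
        ≤ ∑ k ∈ range n, ‖M (n - k) (frobeniusCoeff M g R v₀ k)‖ := norm_sum_le _ _
      _ ≤ ∑ k ∈ range n, K * a ^ (n - k) * (B * μ ^ k) := by
          refine Finset.sum_le_sum fun k hk => ?_
          have hk := mem_range.1 hk
          calc ‖M (n - k) (frobeniusCoeff M g R v₀ k)‖ ≤ ‖M (n - k)‖ * ‖frobeniusCoeff M g R v₀ k‖ :=
                (M (n - k)).le_opNorm _
            _ ≤ K * a ^ (n - k) * (B * μ ^ k) :=
                mul_le_mul (hM _ (by omega)) (ih k hk) (norm_nonneg _) (by positivity)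
      _ = K * B * S := by
          rw [hS, Finset.mul_sum]
          exact Finset.sum_congr rfl fun k _ => by ring
  have han : a ^ n ≤ μ ^ n := pow_le_pow_left₀ ha hμ.le n
  calc ‖frobeniusCoeff M g R v₀ n‖
      = ‖R n (∑ k ∈ range n, M (n - k) (frobeniusCoeff M g R v₀ k) + g n)‖ := by
        rw [frobeniusCoeff_of_ne_zero M g R v₀ hn1.ne']
    _ ≤ ‖R n‖ * ‖∑ k ∈ range n, M (n - k) (frobeniusCoeff M g R v₀ k) + g n‖ := (R n).le_opNorm _
    _ ≤ c / n * (K * B * S + G * a ^ n) :=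
        mul_le_mul (hRn n hn1) ((norm_add_le _ _).trans (add_le_add hsum (hg n hn1))) (norm_nonneg _)
          (by positivity)
    _ ≤ c / n * (K * B * (a * μ ^ n / (μ - a)) + G * μ ^ n) := by
        refine mul_le_mul_of_nonneg_left (add_le_add (mul_le_mul_of_nonneg_left hSle (by positivity))
          (mul_le_mul_of_nonneg_left han hG)) (by positivity)
    _ = (c * (K * B * a / (μ - a) + G)) / n * μ ^ n := by
        field_simp
    _ ≤ (N * B) / n * μ ^ n := by
        refine mul_le_mul_of_nonneg_right (div_le_div_of_nonneg_right hN hn0.le) (by positivity)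
    _ ≤ B * μ ^ n := by
        refine mul_le_mul_of_nonneg_right ?_ (by positivity)
        rw [div_le_iff₀ hn0]
        have : (N : ℝ) ≤ n := by exact_mod_cast hn
        nlinarith

/-! ### The equations on the disc of ANY proven coefficient bound -/

section OfBound

variable {M : ℕ → E →L[𝕜] E} {g : ℕ → E} {R : ℕ → E →L[𝕜] E} {v₀ : E} {a K G c : ℝ}

/-- **THE ANALYTIC BRANCH ON THE SHARP DISC.** Under `IsFrobeniusData M g R v₀ a K G c`, ANY proven bound
`‖vₙ‖ ≤ B μⁿ` with `μ ≥ a` (e.g. from `norm_frobeniusCoeff_le_of_jet`) makes the Frobenius series converge, be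
differentiable, and solve `x • v′(x) = (Σ xᵏ • Mₖ) v(x) + Σ xᵏ • gₖ` on the whole disc `μ‖x‖ < 1` — the same proof as
`IsFrobeniusData.frobeniusSol_ode`, with the built-in majorant replaced by the supplied one.
[cite: CoddingtonLevinson1955, Ch. 4 §3] -/
theorem IsFrobeniusData.frobeniusSol_ode_of_bound [CompleteSpace E] (h : IsFrobeniusData M g R v₀ a K G c)
    {B μ : ℝ} (hw : ∀ n, ‖frobeniusCoeff M g R v₀ n‖ ≤ B * μ ^ n) (haμ : a ≤ μ) {x : 𝕜} (hx : μ * ‖x‖ < 1) :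
    HasSum (fun n => x ^ n • frobeniusCoeff M g R v₀ n) (frobeniusSol M g R v₀ x) ∧
      HasDerivAt (frobeniusSol M g R v₀) (∑' n : ℕ, ((n : 𝕜) * x ^ (n - 1)) • frobeniusCoeff M g R v₀ n) x ∧
      x • deriv (frobeniusSol M g R v₀) x =
        (∑' k, x ^ k • M k) (frobeniusSol M g R v₀ x) + ∑' k, x ^ k • g k := by
  have hμ0 : 0 ≤ μ := h.a_nonneg.trans haμ
  have hax : a * ‖x‖ < 1 := lt_of_le_of_lt (mul_le_mul_of_nonneg_right haμ (norm_nonneg x)) hx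
  refine ⟨(summable_norm_pow_smul hw hμ0 hx).of_norm.hasSum, (hasDerivAt_tsum_pow_smul hw hμ0 hx).2, ?_⟩
  have h1 := hasSum_pow_smul_natCast_smul hw hμ0 hx
  have h2 := (hasSum_pow_smul_sum_antidiagonal h.norm_M_le' h.a_nonneg hw hμ0 hax hx).add
    (summable_norm_pow_smul h.norm_g_le' h.a_nonneg hax).of_norm.hasSum
  have heq : (fun n : ℕ => x ^ n • ((n : 𝕜) • frobeniusCoeff M g R v₀ n)) = fun n : ℕ =>
      x ^ n • ∑ kl ∈ antidiagonal n, M kl.1 (frobeniusCoeff M g R v₀ kl.2) + x ^ n • g n := by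
    funext n
    rw [frobeniusCoeff_antidiagonal h.rightInverse h.compat n, smul_add]
  rw [heq] at h1
  exact h1.unique h2

/-- **THE LOGARITHMIC BRANCH ON THE SHARP DISC.** Under the homogeneous data `IsFrobeniusData M 0 R s₀ a K 0 c`, the
resonant compatibility `M₀ w₀ = κ s₀`, and ANY proven bounds `‖sₙ‖ ≤ B_s μⁿ`, `‖wₙ‖ ≤ B_w μⁿ` (`μ ≥ a`) on the
coefficients of the small solution and of the regular part: at every `x ≠ 0` with `μ‖x‖ < 1` where `ℓ′(x) = x⁻¹`,
`Y_L = κ ℓ • Y_s + W` is differentiable and `x • Y_L′(x) = (Σ xᵏ • Mₖ) Y_L(x)`. [cite: CoddingtonLevinson1955, Ch. 4 §8] -/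
theorem IsFrobeniusData.frobeniusLogSol_ode_of_bound [CompleteSpace E]
    (h : IsFrobeniusData M (fun _ => 0) R v₀ a K 0 c) {κ : 𝕜} {w₀ : E} (hw0 : M 0 w₀ = κ • v₀) {Bs Bw μ : ℝ}
    (hs : ∀ n, ‖frobeniusCoeff M (fun _ => 0) R v₀ n‖ ≤ Bs * μ ^ n)
    (hw : ∀ n, ‖frobeniusCoeff M (logBranchInhom M R v₀ κ) R w₀ n‖ ≤ Bw * μ ^ n) (haμ : a ≤ μ)
    {ℓ : 𝕜 → 𝕜} {x : 𝕜} (hx : μ * ‖x‖ < 1) (hx0 : x ≠ 0) (hℓ : HasDerivAt ℓ x⁻¹ x) :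
    DifferentiableAt 𝕜 (frobeniusLogSol M R v₀ κ w₀ ℓ) x ∧
      x • deriv (frobeniusLogSol M R v₀ κ w₀ ℓ) x = (∑' k, x ^ k • M k) (frobeniusLogSol M R v₀ κ w₀ ℓ x) := by
  obtain ⟨hYsum, hYd, hYode⟩ := h.frobeniusSol_ode_of_bound hs haμ hx
  -- Frobenius data for the regular part with rate `μ` and `G = ‖κ‖ B_s` (from the supplied bound on `s`)
  have hBs : 0 ≤ Bs := by simpa using (norm_nonneg _).trans (hs 0)
  have hW' : IsFrobeniusData M (logBranchInhom M R v₀ κ) R w₀ μ K (‖κ‖ * Bs) c :=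
    { a_nonneg := h.a_nonneg.trans haμ
      K_nonneg := h.K_nonneg
      G_nonneg := by positivity
      c_nonneg := h.c_nonneg
      norm_M_le := fun k hk => (h.norm_M_le k hk).trans
        (mul_le_mul_of_nonneg_left (pow_le_pow_left₀ h.a_nonneg haμ k) h.K_nonneg)
      norm_g_le := fun k _ => by
        rw [logBranchInhom, norm_neg, norm_smul, mul_assoc]
        exact mul_le_mul_of_nonneg_left (hs k) (norm_nonneg _)
      rightInverse := h.rightInverse
      norm_R_le := h.norm_R_le
      compat := by rw [logBranchInhom_zero, hw0, add_neg_cancel] }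
  obtain ⟨-, hWd, hWode⟩ := hW'.frobeniusSol_ode_of_bound hw le_rfl hx
  have hg : (∑' k, x ^ k • logBranchInhom M R v₀ κ k) = -(κ • frobeniusSol M (fun _ => 0) R v₀ x) := by
    have hS := (hYsum.const_smul κ).neg
    refine HasSum.tsum_eq ?_
    convert hS using 1
    funext k
    rw [logBranchInhom, smul_neg, smul_comm]
  have hYs_eq : x • deriv (frobeniusSol M (fun _ => 0) R v₀) x =
      (∑' k, x ^ k • M k) (frobeniusSol M (fun _ => 0) R v₀ x) := by
    rw [hYode, tsum_congr (fun k => smul_zero (x ^ k)), tsum_zero, add_zero]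
  have hW_eq : x • deriv (frobeniusSol M (logBranchInhom M R v₀ κ) R w₀) x =
      (∑' k, x ^ k • M k) (frobeniusSol M (logBranchInhom M R v₀ κ) R w₀ x)
        - κ • frobeniusSol M (fun _ => 0) R v₀ x := by
    rw [hWode, hg, sub_eq_add_neg]
  have key := hasDerivAt_logComb (∑' k, x ^ k • M k) hx0 hℓ hYd.differentiableAt.hasDerivAt
    hWd.differentiableAt.hasDerivAt hYs_eq hW_eq
  refine ⟨key.1.differentiableAt, ?_⟩
  rw [show frobeniusLogSol M R v₀ κ w₀ ℓ = fun z => κ • ℓ z • frobeniusSol M (fun _ => 0) R v₀ z +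
      frobeniusSol M (logBranchInhom M R v₀ κ) R w₀ z from rfl, key.1.deriv]
  exact key.2

end OfBound

/-! ### Scalar form (`x y″ + p y′ + q y = 0`, `p₀ = 0`): the small solution and the log branch on the sharp disc -/

section Scalar

variable {pc qc : ℕ → 𝕜} {p q : 𝕜 → 𝕜} {a K ρ₀ : ℝ}

/-- **SMALL SOLUTION ON THE SHARP DISC.** Under `IsScalarLogData pc qc p q a K ρ₀` and ANY proven bound
`‖sₙ‖ ≤ B_s μⁿ` (`μ ≥ a`) on the coefficients of `scalarSmallSol`: at every `x` with `‖x‖ < ρ₀`, `μ‖x‖ < 1` the pair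
`(y_s, y_s′)` is differentiable, `y_s′` is the derivative of `y_s` (`x ≠ 0`) and `x y_s″ + p y_s′ + q y_s = 0`.
[cite: CoddingtonLevinson1955, Ch. 4 §8] -/
theorem IsScalarLogData.smallSol_of_bound (h : IsScalarLogData pc qc p q a K ρ₀) {Bs μ : ℝ}
    (hs : ∀ n, ‖frobeniusCoeff (scalarSysM pc qc) (fun _ => 0) (scalarSysR pc qc) ((0 : 𝕜), (1 : 𝕜)) n‖
      ≤ Bs * μ ^ n) (haμ : a ≤ μ) {x : 𝕜} (hxρ : ‖x‖ < ρ₀) (hx : μ * ‖x‖ < 1) :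
    DifferentiableAt 𝕜 (scalarSmallSol pc qc) x ∧
      (x ≠ 0 → HasDerivAt (fun z => (scalarSmallSol pc qc z).1) ((scalarSmallSol pc qc x).2) x) ∧
      HasDerivAt (fun z => (scalarSmallSol pc qc z).2) ((deriv (scalarSmallSol pc qc) x).2) x ∧
      x * (deriv (scalarSmallSol pc qc) x).2 + p x * (scalarSmallSol pc qc x).2
        + q x * (scalarSmallSol pc qc x).1 = 0 := by
  obtain ⟨-, hd, hode⟩ := h.small.frobeniusSol_ode_of_bound hs haμ hx
  change HasDerivAt (scalarSmallSol pc qc) _ x at hd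
  change x • deriv (scalarSmallSol pc qc) x =
    (∑' k, x ^ k • scalarSysM pc qc k) (scalarSmallSol pc qc x) + ∑' k : ℕ, x ^ k • (0 : 𝕜 × 𝕜) at hode
  have hax : a * ‖x‖ < 1 := lt_of_le_of_lt (mul_le_mul_of_nonneg_right haμ (norm_nonneg x)) hx
  rw [tsum_scalarSysM_apply pc qc h.a_pos.le h.small.norm_M_le' hax (h.hasSum_p x hxρ) (h.hasSum_q x hxρ),
    tsum_congr (fun k => smul_zero (x ^ k)), tsum_zero, add_zero] at hode
  have hd' := hd.differentiableAt.hasDerivAt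
  have e1 := congrArg Prod.fst hode
  have e2 := congrArg Prod.snd hode
  simp only [Prod.smul_fst, Prod.smul_snd, smul_eq_mul] at e1 e2
  refine ⟨hd.differentiableAt, fun hx0 => ?_,
    (ContinuousLinearMap.snd 𝕜 𝕜 𝕜).hasFDerivAt.comp_hasDerivAt x hd', ?_⟩
  · have key : (deriv (scalarSmallSol pc qc) x).1 = (scalarSmallSol pc qc x).2 := mul_left_cancel₀ hx0 e1
    rw [← key]
    exact (ContinuousLinearMap.fst 𝕜 𝕜 𝕜).hasFDerivAt.comp_hasDerivAt x hd'
  · rw [e2]; ring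

/-- **LOG BRANCH ON THE SHARP DISC.** Under `IsScalarLogData pc qc p q a K ρ₀` and ANY proven bounds
`‖sₙ‖ ≤ B_s μⁿ`, `‖wₙ‖ ≤ B_w μⁿ` (`μ ≥ a`) on the coefficients of `scalarSmallSol` and `scalarLogRegSol η₀ ζ₀`: at
every `x ≠ 0` with `‖x‖ < ρ₀`, `μ‖x‖ < 1` where `ℓ′(x) = x⁻¹`, `y_L′` is the derivative of `y_L`, is differentiable, and
`x y_L″ + p y_L′ + q y_L = 0` (the conclusions of `IsScalarLogData.logSol`, on the disc of the supplied bounds — with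
`norm_frobeniusCoeff_le_of_jet`, up to the true radius). [cite: CoddingtonLevinson1955, Ch. 4 §8] -/
theorem IsScalarLogData.logSol_of_bound (h : IsScalarLogData pc qc p q a K ρ₀) (η₀ ζ₀ : 𝕜) {Bs Bw μ : ℝ}
    (hs : ∀ n, ‖frobeniusCoeff (scalarSysM pc qc) (fun _ => 0) (scalarSysR pc qc) ((0 : 𝕜), (1 : 𝕜)) n‖
      ≤ Bs * μ ^ n)
    (hw : ∀ n, ‖frobeniusCoeff (scalarSysM pc qc)
      (logBranchInhom (scalarSysM pc qc) (scalarSysR pc qc) ((0 : 𝕜), (1 : 𝕜)) (-(qc 0) * η₀))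
      (scalarSysR pc qc) (η₀, ζ₀) n‖ ≤ Bw * μ ^ n)
    (haμ : a ≤ μ) {ℓ : 𝕜 → 𝕜} {x : 𝕜} (hxρ : ‖x‖ < ρ₀) (hx : μ * ‖x‖ < 1) (hx0 : x ≠ 0)
    (hℓ : HasDerivAt ℓ x⁻¹ x) :
    HasDerivAt (fun z => (scalarLogSol pc qc η₀ ζ₀ ℓ z).1) ((scalarLogSol pc qc η₀ ζ₀ ℓ x).2) x ∧
      HasDerivAt (fun z => (scalarLogSol pc qc η₀ ζ₀ ℓ z).2) ((deriv (scalarLogSol pc qc η₀ ζ₀ ℓ) x).2) x ∧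
      x * (deriv (scalarLogSol pc qc η₀ ζ₀ ℓ) x).2 + p x * (scalarLogSol pc qc η₀ ζ₀ ℓ x).2
        + q x * (scalarLogSol pc qc η₀ ζ₀ ℓ x).1 = 0 := by
  obtain ⟨hdiff, hode⟩ :=
    h.small.frobeniusLogSol_ode_of_bound (scalarSysM_zero_resonant h.pc_zero η₀ ζ₀) hs hw haμ hx hx0 hℓ
  change DifferentiableAt 𝕜 (scalarLogSol pc qc η₀ ζ₀ ℓ) x at hdiff
  change x • deriv (scalarLogSol pc qc η₀ ζ₀ ℓ) x =
    (∑' k, x ^ k • scalarSysM pc qc k) (scalarLogSol pc qc η₀ ζ₀ ℓ x) at hode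
  have hax : a * ‖x‖ < 1 := lt_of_le_of_lt (mul_le_mul_of_nonneg_right haμ (norm_nonneg x)) hx
  rw [tsum_scalarSysM_apply pc qc h.a_pos.le h.small.norm_M_le' hax (h.hasSum_p x hxρ) (h.hasSum_q x hxρ)]
    at hode
  have hd := hdiff.hasDerivAt
  have e1 := congrArg Prod.fst hode
  have e2 := congrArg Prod.snd hode
  simp only [Prod.smul_fst, Prod.smul_snd, smul_eq_mul] at e1 e2
  refine ⟨?_, (ContinuousLinearMap.snd 𝕜 𝕜 𝕜).hasFDerivAt.comp_hasDerivAt x hd, ?_⟩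
  · have key : (deriv (scalarLogSol pc qc η₀ ζ₀ ℓ) x).1 = (scalarLogSol pc qc η₀ ζ₀ ℓ x).2 :=
      mul_left_cancel₀ hx0 e1
    rw [← key]
    exact (ContinuousLinearMap.fst 𝕜 𝕜 𝕜).hasFDerivAt.comp_hasDerivAt x hd
  · rw [e2]; ring

end Scalar

end Literature.Analysis.ODE

end
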